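import Summits.CriticalPhenomena.PercolationContinuityZ3.Theorems.Transplant.FKDoubleFanSpokesAdjacent
import HarnessLib

/-!
# Double fans: a RIM EDGE and a SPOKE at one of its endpoints are negatively correlated (algebra level, every `0 ≤ q ≤ 1`)

Helper file (`--supports stmt-CriticalPhenomena-4575`), FK sub-lane `prim-bschramm-fk-3` (gen 21); builds on p205010 (kernel theorem, internal
audit signed; external expert review pending).  Pure real algebra: no measures, no named facts, no sorries; standard axioms.  Memo
`bschramm/prim-bschramm-fk-3/DOUBLE-FAN.md` §3 (generalized T1) and the gen-21 memo `RIM-PAIRS.md`.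

Setting (`…ThreeApexRimStep`, `…DoubleFanSpokesAdjacent`): a double fan is read by the three-apex transfer on the moving boundary
`{a = N, b = S, c}` plus the rim step `E_r = r·id + (1−r)·detach`.  For the pair `e = c_i c_{i+1}` (rim edge, operator `E_r` itself:
contracted `= E_1 = id`, deleted `= E_0 = detach`) and `f = a c_{i+1}` (the `a`-spoke of the NEW rim vertex), with `u` the fibre-mass vector of
everything up to `c_i` and `s` that of everything from `c_{i+1}` on (its other spoke included, read backwards), the four pinned partition functions
are `Z^{βα} = val_q(s ∗ M(ac)^α · E_β u)` (**`rimSpokeAZ`**).  With the trivial continuation `s = edgeBC(y)·δ_0` this is type T1 of `K_{1,1,1,n}`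
(two edges at one leaf); here `s` is arbitrary.  **`rayleigh_rim_spokeA_eq`**: the Rayleigh difference `Z¹⁰Z⁰¹ − Z¹¹Z⁰⁰` equals `q²(1−q)` times an
explicit combination (**`rimSpokeCert`**, 77 products, found by linear programming over the product cone and verified by `ring`) of products
`P(q)·F(u)·G(s)` with `P ≥ 0` on `[0,1]` and `F, G` among the eight valid forms of `…ThreeApexRimStep` (`N^{(ac)}, N^{(ab)}, N^{(bc)}, κ_ac, κ_ab,
κ_bc, Λ`) and products of two masses.  Hence (**`rayleigh_rim_spokeA_nonneg`**) it is `≥ 0` whenever `u, s` are `Valid` — in particular on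
`InKE q × InKE q` (**`InKE.rayleigh_rim_spokeA_nonneg`**) — and symmetrically for the `b`-spoke (**`InKE.rayleigh_rim_spokeB_nonneg`**).  By the
self-adjointness of the rim step (`val_conv_rimStep`) the same inequality covers the spoke of the OLD rim vertex `a c_i` against `c_i c_{i+1}`
(roles of `u` and `s` exchanged); the measure-level statements are the next file.
NOT here: the rim edge against the axis or against a spoke two blocks away (cross-`c` pairs of generalized-T5 type; they need the `U`-forms).
[cite: Grimmett2006, §3.9 eq. (3.94) (pp. 63–64)] [cite: Wagner2006, Conj. 5.3 (p. 13)] [folklore]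
-/

noncomputable section

namespace Summit.CriticalPhenomena.PercolationContinuityZ3.Theorems

namespace FK

namespace ThreeApex

/-! ### The pinned partition functions -/

/-- The pinned partition function `Z^{βα} = val_q(s ∗ M(ac)^α E_β u)`: rim edge in state `β` (`E_1 = id` contracted, `E_0 = detach` deleted)
followed by the `a`-spoke of the new rim vertex in state `α`, against the rest `s`. [folklore] -/
def rimSpokeAZ (q : ℝ) (u s : V5) (β α : ℝ) : ℝ :=
  val q (conv s (conv (edgeAC α) (rimStep q β u)))

/-- The same with the `b`-spoke of the new rim vertex. [folklore] -/
def rimSpokeBZ (q : ℝ) (u s : V5) (β α : ℝ) : ℝ :=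
  val q (conv s (conv (edgeBC α) (rimStep q β u)))

/-- `a ↔ b` turns the `b`-spoke valuation into the `a`-spoke valuation of the swapped vectors. [folklore] -/
theorem rimSpokeBZ_eq_swapAB (q : ℝ) (u s : V5) (β α : ℝ) :
    rimSpokeBZ q u s β α = rimSpokeAZ q (swapAB u) (swapAB s) β α := by
  simp only [rimSpokeBZ, rimSpokeAZ, val, conv, edgeAC, edgeBC, rimStep, swapAB, V5.total]
  ring

/-! ### The certificate -/

/-- **The product-cone certificate** for the pair (rim edge, spoke at its new endpoint): a sum of 77 products `P(q)·F(u)·G(s)`, `P ≥ 0` on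
`[0,1]` (written in power or Bernstein form), `F, G` valid forms or products of two masses.  Found by exact linear programming (gen 21). [folklore] -/
def rimSpokeCert (q : ℝ) (u s : V5) : ℝ :=
    1 * masterN q u * masterN q (swapBC s)
    + 1 * masterN q u * masterN q (swapAB s)
    + (q * (1 - q) ^ 2 + 2 * q ^ 2 * (1 - q)) * masterN q u * kap (swapBC s)
    + (q * (1 - q) ^ 2 + 2 * q ^ 2 * (1 - q)) * masterN q u * kap (swapAB s)
    + q * (1 - q) ^ 2 * masterN q u * lam s
    + q ^ 2 * masterN q u * (s.z0 * s.z0)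
    + q ^ 3 * masterN q u * (s.z0 * s.z1)
    + q ^ 3 * masterN q u * (s.z0 * s.zab)
    + q ^ 2 * masterN q u * (s.z0 * s.zac)
    + q ^ 3 * masterN q u * (s.z0 * s.zbc)
    + q * (1 - q) ^ 2 * masterN q u * (s.zab * s.zbc)
    + 1 * masterN q (swapAB u) * masterN q (swapBC s)
    + 2 * q * (1 - q) ^ 2 * kap u * lam s
    + 2 * q * (1 - q) ^ 2 * kap u * (s.zab * s.zbc)
    + (2 * (1 - q) ^ 3 + 4 * q * (1 - q) ^ 2 + 2 * q ^ 2 * (1 - q)) * lam u * masterN q (swapBC s)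
    + q ^ 2 * (1 - q) * lam u * kap s
    + (q * (1 - q) ^ 2 + q ^ 2 * (1 - q)) * lam u * kap (swapAB s)
    + q ^ 2 * (1 - q) * lam u * (s.z0 * s.z0)
    + (q * (1 - q) ^ 2 + q ^ 2 * (1 - q)) * lam u * (s.z0 * s.zbc)
    + q * (1 - q) ^ 2 * lam u * (s.zac * s.zbc)
    + q * (u.z0 * u.z1) * masterN q (swapBC s)
    + q ^ 2 * (u.z0 * u.z1) * kap s
    + (2 * q * (1 - q) ^ 2 + q ^ 2 * (1 - q)) * (u.z0 * u.z1) * kap (swapBC s)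
    + q ^ 2 * (u.z0 * u.z1) * (s.z0 * s.z0)
    + (2 * q ^ 2 * (1 - q) + q ^ 3) * (u.z0 * u.z1) * (s.z0 * s.zab)
    + q ^ 2 * (u.z0 * u.z1) * (s.z0 * s.zbc)
    + (2 * q ^ 2 * (1 - q) + q ^ 3) * (u.z0 * u.z1) * (s.zab * s.zbc)
    + 1 * (u.z1 * u.z1) * masterN q (swapBC s)
    + ((1 - q) ^ 3 + 5 * q * (1 - q) ^ 2 + q ^ 2 * (1 - q) + q ^ 3) * (u.z1 * u.z1) * kap (swapBC s)
    + 1 * (u.z1 * u.z1) * (s.z0 * s.z0)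
    + ((1 - q) ^ 3 + 3 * q ^ 2 * (1 - q)) * (u.z1 * u.z1) * (s.z0 * s.z1)
    + ((1 - q) ^ 3 + 3 * q ^ 2 * (1 - q)) * (u.z1 * u.z1) * (s.z0 * s.zab)
    + 1 * (u.z1 * u.z1) * (s.z0 * s.zac)
    + 1 * (u.z1 * u.z1) * (s.z0 * s.zbc)
    + (3 * q * (1 - q) ^ 2 + q ^ 3) * (u.z1 * u.z1) * (s.zac * s.zbc)
    + q * (u.zab * u.z1) * masterN q (swapBC s)
    + (q * (1 - q) ^ 2 + q ^ 2 * (1 - q) + q ^ 3) * (u.zab * u.z1) * kap (swapBC s)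
    + q * (u.zab * u.z1) * (s.z0 * s.z0)
    + (q * (1 - q) ^ 2 + 2 * q ^ 2 * (1 - q)) * (u.zab * u.z1) * (s.z0 * s.z1)
    + (q * (1 - q) ^ 2 + 2 * q ^ 2 * (1 - q)) * (u.zab * u.z1) * (s.z0 * s.zab)
    + q * (u.zab * u.z1) * (s.z0 * s.zac)
    + q * (u.zab * u.z1) * (s.z0 * s.zbc)
    + q ^ 3 * (u.zab * u.z1) * (s.zac * s.zbc)
    + q ^ 2 * (1 - q) * (u.zab * u.zac) * kap s
    + q ^ 2 * (1 - q) * (u.zab * u.zac) * (s.z0 * s.z0)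
    + (2 * q * (1 - q) ^ 2 + 2 * q ^ 2 * (1 - q)) * (u.zab * u.zac) * (s.z0 * s.zbc)
    + (2 * q * (1 - q) ^ 2 + q ^ 2 * (1 - q)) * (u.zab * u.zac) * (s.zac * s.zbc)
    + q ^ 2 * (1 - q) * (u.zab * u.zbc) * lam s
    + q ^ 2 * (1 - q) * (u.zab * u.zbc) * (s.zab * s.zac)
    + 1 * (u.zac * u.z1) * masterN q (swapBC s)
    + 3 * q ^ 2 * (1 - q) * (u.zac * u.z1) * kap s
    + (2 * (1 - q) ^ 3 + 2 * q * (1 - q) ^ 2 + q ^ 2 * (1 - q)) * (u.zac * u.z1) * kap (swapBC s)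
    + (2 * (1 - q) ^ 3 + 2 * q * (1 - q) ^ 2) * (u.zac * u.z1) * kap (swapAB s)
    + (2 * q * (1 - q) ^ 2 + 3 * q ^ 2 * (1 - q) + q ^ 3) * (u.zac * u.z1) * (s.z0 * s.z0)
    + (3 * q * (1 - q) ^ 2 + q ^ 3) * (u.zac * u.z1) * (s.z0 * s.z1)
    + (3 * q * (1 - q) ^ 2 + 3 * q ^ 2 * (1 - q) + q ^ 3) * (u.zac * u.z1) * (s.z0 * s.zab)
    + (2 * q * (1 - q) ^ 2 + q ^ 3) * (u.zac * u.z1) * (s.z0 * s.zac)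
    + (3 * q * (1 - q) ^ 2 + 4 * q ^ 2 * (1 - q) + q ^ 3) * (u.zac * u.z1) * (s.z0 * s.zbc)
    + 3 * q ^ 2 * (1 - q) * (u.zac * u.z1) * (s.zab * s.zbc)
    + q ^ 2 * (1 - q) * (u.zac * u.z1) * (s.zac * s.zbc)
    + (2 * (1 - q) ^ 3 + 2 * q * (1 - q) ^ 2) * (u.zac * u.zac) * lam s
    + (2 * (1 - q) ^ 3 + 2 * q * (1 - q) ^ 2) * (u.zac * u.zac) * (s.zab * s.zbc)
    + (2 * (1 - q) ^ 3 + 4 * q * (1 - q) ^ 2 + 2 * q ^ 2 * (1 - q)) * (u.zac * u.zbc) * masterN q (swapBC s)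
    + q ^ 2 * (1 - q) * (u.zac * u.zbc) * kap s
    + (2 * q * (1 - q) ^ 2 + q ^ 2 * (1 - q)) * (u.zac * u.zbc) * kap (swapAB s)
    + (2 * (1 - q) ^ 3 + q * (1 - q) ^ 2) * (u.zac * u.zbc) * lam s
    + q ^ 2 * (1 - q) * (u.zac * u.zbc) * (s.z0 * s.z0)
    + q ^ 2 * (1 - q) * (u.zac * u.zbc) * (s.z0 * s.zbc)
    + (2 * (1 - q) ^ 3 + q * (1 - q) ^ 2) * (u.zac * u.zbc) * (s.zab * s.zbc)
    + 1 * (u.zbc * u.z1) * masterN q (swapBC s)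
    + (2 * (1 - q) ^ 3 + 4 * q * (1 - q) ^ 2 + 4 * q ^ 2 * (1 - q) + q ^ 3) * (u.zbc * u.z1) * kap (swapBC s)
    + q * (u.zbc * u.z1) * (s.z0 * s.z0)
    + q * (1 - q) ^ 2 * (u.zbc * u.z1) * (s.z0 * s.z1)
    + q * (1 - q) ^ 2 * (u.zbc * u.z1) * (s.z0 * s.zab)
    + q * (u.zbc * u.z1) * (s.z0 * s.zac)
    + q * (u.zbc * u.z1) * (s.z0 * s.zbc)
    + (2 * q ^ 2 * (1 - q) + q ^ 3) * (u.zbc * u.z1) * (s.zac * s.zbc)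

/-- **Exact identity**: `Z¹⁰Z⁰¹ − Z¹¹Z⁰⁰ = q²(1−q)·rimSpokeCert`. [folklore] -/
theorem rayleigh_rim_spokeA_eq (q : ℝ) (u s : V5) :
    rimSpokeAZ q u s 1 0 * rimSpokeAZ q u s 0 1 - rimSpokeAZ q u s 1 1 * rimSpokeAZ q u s 0 0 =
      q ^ 2 * (1 - q) * rimSpokeCert q u s := by
  simp only [rimSpokeAZ, rimSpokeCert, val, conv, edgeAC, rimStep, masterN, kap, lam, swapAB, swapBC, V5.total]
  ring

/-- The certificate is non-negative for valid `u, s` and `0 ≤ q ≤ 1`. [folklore] -/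
theorem rimSpokeCert_nonneg {q : ℝ} (hq0 : 0 ≤ q) (hq1 : q ≤ 1) {u s : V5} (hu : Valid q u) (hs : Valid q s) :
    0 ≤ rimSpokeCert q u s := by
  obtain ⟨⟨hu0, hu1, hu2, hu3, hu4⟩, unac, unab, unbc, ulam, ukA, ukB, ukC⟩ := hu
  obtain ⟨⟨hs0, hs1, hs2, hs3, hs4⟩, snac, snab, snbc, slam, skA, skB, skC⟩ := hs
  have hq' : 0 ≤ 1 - q := sub_nonneg.2 hq1
  unfold rimSpokeCert
  positivity

/-- **A rim edge and the `a`-spoke at its new endpoint are negatively correlated** (algebra level): the Rayleigh difference is `≥ 0` for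
`0 ≤ q ≤ 1` and valid `u, s`. [folklore] -/
theorem rayleigh_rim_spokeA_nonneg {q : ℝ} (hq0 : 0 ≤ q) (hq1 : q ≤ 1) {u s : V5} (hu : Valid q u) (hs : Valid q s) :
    0 ≤ rimSpokeAZ q u s 1 0 * rimSpokeAZ q u s 0 1 - rimSpokeAZ q u s 1 1 * rimSpokeAZ q u s 0 0 := by
  rw [rayleigh_rim_spokeA_eq]
  have hq' : 0 ≤ 1 - q := sub_nonneg.2 hq1
  have hc := rimSpokeCert_nonneg hq0 hq1 hu hs
  positivity

/-- The same for rests in the rim-step closure `InKE q` (prefix and reversed suffix of a double fan with leaves). [folklore] -/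
theorem InKE.rayleigh_rim_spokeA_nonneg {q : ℝ} (hq0 : 0 ≤ q) (hq1 : q ≤ 1) {u s : V5} (hu : InKE q u) (hs : InKE q s) :
    0 ≤ rimSpokeAZ q u s 1 0 * rimSpokeAZ q u s 0 1 - rimSpokeAZ q u s 1 1 * rimSpokeAZ q u s 0 0 :=
  ThreeApex.rayleigh_rim_spokeA_nonneg hq0 hq1 (hu.valid hq0 hq1) (hs.valid hq0 hq1)

/-- **A rim edge and the `b`-spoke at its new endpoint** (the `a ↔ b` image), for rests in `InKE q`. [folklore] -/
theorem InKE.rayleigh_rim_spokeB_nonneg {q : ℝ} (hq0 : 0 ≤ q) (hq1 : q ≤ 1) {u s : V5} (hu : InKE q u) (hs : InKE q s) :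
    0 ≤ rimSpokeBZ q u s 1 0 * rimSpokeBZ q u s 0 1 - rimSpokeBZ q u s 1 1 * rimSpokeBZ q u s 0 0 := by
  simp only [rimSpokeBZ_eq_swapAB]
  exact InKE.rayleigh_rim_spokeA_nonneg hq0 hq1 hu.swapAB hs.swapAB

end ThreeApex

end FK

end Summit.CriticalPhenomena.PercolationContinuityZ3.Theorems
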